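import Literature.ModelTheory.ExponentialFields.SemialgebraicLenses
import HarnessLib

/-!
# Thick ladders (capsule refinement subordinate to an open cover, III: the middle pieces)

Topic `Literature/ModelTheory/ExponentialFields` — block B2c₁ of the proof of the
`C¹`-triangulation theorem for compact semialgebraic sets
(`Literature.ModelTheory.ExponentialFields.OhmotoShiota2017_c1Triangulation`, statement of
[OhmotoShiota2017, Thm. 1.1]) along the proof of [Pawlucki2024], specialized to `p = 1`.

**The final claim of the proof of [Pawlucki2024, Prop. 2.5] (Part II, p. 3872), in rich-cut form.**
Inside a *free window* `[γ, δ]` (continuous functions, `γ < δ` on the open set `Fr`, pinching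
`γ = δ` at the rim `cl Fr ∖ Fr`, closed fibres covered by the open sets `V j`), over a stratum `B ⊆ Fr`
(a cell with its chart) carrying a *ladder* `γ = ψ₀ < ψ₁ < ⋯ < ψ_M = δ` of continuous sections each
of whose CLOSED pieces lies in a single `V (jb ν)`, and a set `K ⊆ B` staying away from the
nondegenerate frontier `E_B = ∂B ∩ Fr` of the stratum, we build finitely many continuous
semialgebraic cut functions on `ℝᵐ` and an open semialgebraic neighbourhood `U_B` of `K` such that
the cut family is valid (`RCValid γ δ V`) at every point of `U_B ∩ Fr`.

This is Pawłucki's "similar neighbourhood over every `B_ν`" (the thickening of the pieces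
`[φ_{μ-1}|T₂, φ̃_μ]`), made explicit: the cuts are `c_ν = spine + χ · θ · (ψ_ν ∘ π - spine)` with
`spine = (γ + δ)/2`, a tube cutoff `θ` (pinching towards the frontier of the chart domain) and a
separation cutoff `χ` (`= 1` near `K`, `→ 0` at `E_B`); on `U_B` all cuts are the translated ladder
`ψ_ν ∘ π`, whose closed pieces stay in their `V` by the disc argument, the two end bits being
controlled by the distance of the corner points `(π x, γ(π x))`, `(π x, δ(π x))` to the complement
of their `V`.  Continuity at the rim is the squeeze `γ = δ`; at `E_B` it is `χ → 0`.

No named facts are introduced (D-0026).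

## References

* [Pawlucki2024] W. Pawłucki, *Strict `C^p`-triangulations — a new approach to
  desingularization*, J. Eur. Math. Soc. 26 (2024), 3863–3909, Prop. 2.5, proof, Part II
  (p. 3872).
* [Dries1998] L. van den Dries, *Tame topology and o-minimal structures*, Ch. 3 (2.7).
* [OhmotoShiota2017] T. Ohmoto, M. Shiota, *`C¹`-triangulations of semialgebraic sets*,
  J. Topology 10 (2017), Thm. 1.1 (statement only).
-/

noncomputable section

open Set Filter Metric
open _root_.Topology

namespace Literature.ModelTheory.ExponentialFields

open Literature.NumberTheory.Transcendental (IsSemialgebraicFunOn IsSemialgebraicMapOn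
  isSemialgebraicFunOn_iff isSemialgebraicMapOn_iff_forall_holds)
open Literature.NumberTheory.Transcendental.SemialgebraicMonotonicity (sa_and sa_or sa_not sa_imp
  sa_lt sa_le sa_eq sa_sub_lt sa_reindex sa_const_lt sa_lt_const sa_le_const sa_const_le)

/-! ### Charts of cells (generic API) -/

section Chart

variable {m k : ℕ}

/-- A stratum with a chart `x ↦ x ∘ ι` onto an open set `U ⊆ ℝᵏ`, inverse `φ`.
[cite: Dries1998, Ch. 3 (2.7)] -/
structure ChartData (m k : ℕ) where
  /-- the stratum -/
  B : Set (Fin m → ℝ)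
  /-- chart coordinates -/
  ι : Fin k → Fin m
  /-- chart domain -/
  U : Set (Fin k → ℝ)
  /-- chart inverse -/
  φ : (Fin k → ℝ) → (Fin m → ℝ)

/-- Hypotheses of a chart. [cite: Dries1998, Ch. 3 (2.7)] -/
structure ChartData.Hyp (C : ChartData m k) : Prop where
  B_bdd : Bornology.IsBounded C.B
  isOpen_U : IsOpen C.U
  chart_left : ∀ x ∈ C.B, C.φ (x ∘ C.ι) = x
  chart_mem : ∀ x ∈ C.B, x ∘ C.ι ∈ C.U
  chart_right : ∀ u ∈ C.U, C.φ u ∈ C.B ∧ (C.φ u) ∘ C.ι = u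
  φ_cont : ContinuousOn C.φ C.U

/-- Semialgebraicity of a chart. [cite: Dries1998, Ch. 3 (2.7)] -/
structure ChartData.SA (C : ChartData m k) : Prop where
  B_sa : IsSemialgebraic ℝ C.B
  U_sa : IsSemialgebraic ℝ C.U
  φ_sa : IsSemialgebraicMapOn ℝ C.U C.φ

namespace ChartData

variable (C : ChartData m k)

/-- Chart coordinates of a point. [cite: Dries1998, Ch. 3 (2.7)] -/
def pr (x : Fin m → ℝ) : Fin k → ℝ := x ∘ C.ι

/-- The chart cylinder. [cite: Dries1998, Ch. 3 (2.7)] -/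
def Cyl : Set (Fin m → ℝ) := {x | C.pr x ∈ C.U}

/-- The chart projection. [cite: Dries1998, Ch. 3 (2.7)] -/
def proj (x : Fin m → ℝ) : Fin m → ℝ := C.φ (C.pr x)

/-- Transversal size. [cite: Pawlucki2024, Prop. 2.5] -/
def tdist (x : Fin m → ℝ) : ℝ := dist x (C.proj x)

/-- Distance to the complement of the chart domain (`1` if empty). [cite: Pawlucki2024, Prop. 2.5] -/
def δU (u : Fin k → ℝ) : ℝ := by
  classical
  exact if (C.Uᶜ).Nonempty then infDist u C.Uᶜ else 1

variable {C} (H : C.Hyp)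
include H

/-- On the stratum the projection is the identity. [cite: Dries1998, Ch. 3 (2.7)] -/
theorem proj_of_mem {x : Fin m → ℝ} (hx : x ∈ C.B) : C.proj x = x := H.chart_left x hx

/-- The stratum lies in the cylinder. [cite: Dries1998, Ch. 3 (2.7)] -/
theorem mem_Cyl_of_mem {x : Fin m → ℝ} (hx : x ∈ C.B) : x ∈ C.Cyl := H.chart_mem x hx

/-- The projection lands in the stratum. [cite: Dries1998, Ch. 3 (2.7)] -/
theorem proj_mem {x : Fin m → ℝ} (hx : x ∈ C.Cyl) : C.proj x ∈ C.B := (H.chart_right _ hx).1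

/-- The projection preserves chart coordinates. [cite: Dries1998, Ch. 3 (2.7)] -/
theorem pr_proj {x : Fin m → ℝ} (hx : x ∈ C.Cyl) : C.pr (C.proj x) = C.pr x := (H.chart_right _ hx).2

omit H in
/-- `pr` is continuous. [folklore] -/
theorem continuous_pr : Continuous C.pr := continuous_pi fun j => continuous_apply (C.ι j)

omit H in
/-- `pr` is `1`-Lipschitz. [folklore] -/
theorem dist_pr_le (x z : Fin m → ℝ) : dist (C.pr x) (C.pr z) ≤ dist x z :=
  (dist_pi_le_iff dist_nonneg).2 fun j => dist_le_pi_dist x z (C.ι j)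

/-- The cylinder is open. [cite: Dries1998, Ch. 3 (2.7)] -/
theorem isOpen_Cyl : IsOpen C.Cyl := H.isOpen_U.preimage continuous_pr

/-- The projection is continuous on the cylinder. [cite: Dries1998, Ch. 3 (2.7)] -/
theorem continuousOn_proj : ContinuousOn C.proj C.Cyl :=
  H.φ_cont.comp continuous_pr.continuousOn fun _ hx => hx

/-- `tdist` is continuous on the cylinder. [cite: Pawlucki2024, Prop. 2.5] -/
theorem continuousOn_tdist : ContinuousOn C.tdist C.Cyl :=
  continuous_dist.comp_continuousOn (continuousOn_id.prodMk (continuousOn_proj H))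

/-- On the stratum `tdist = 0`. [cite: Pawlucki2024, Prop. 2.5] -/
theorem tdist_of_mem {x : Fin m → ℝ} (hx : x ∈ C.B) : C.tdist x = 0 := by
  unfold tdist; rw [proj_of_mem H hx, dist_self]

/-- **The stratum is closed in its cylinder** (fixed points of `φ ∘ pr`); hence cells are locally
closed. [cite: Dries1998, Ch. 3 (2.7)] -/
theorem B_eq_inter : C.B = C.Cyl ∩ {x | C.proj x = x} := by
  ext x
  constructor
  · intro hx; exact ⟨mem_Cyl_of_mem H hx, proj_of_mem H hx⟩
  · rintro ⟨hx, hpx⟩; rw [← hpx]; exact proj_mem H hx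

/-- The frontier `cl B ∖ B` misses the cylinder. [cite: Dries1998, Ch. 3 (2.7)] -/
theorem closure_diff_eq : closure C.B \ C.B = closure C.B \ C.Cyl := by
  ext x
  simp only [Set.mem_sdiff]
  constructor
  · rintro ⟨hcl, hnB⟩
    refine ⟨hcl, fun hC => hnB ?_⟩
    -- `B` is closed in `Cyl`: pass to the limit in `proj x' = x'`
    rw [B_eq_inter H]
    refine ⟨hC, ?_⟩
    have hcont : ContinuousAt (fun x => C.proj x) x := (continuousOn_proj H).continuousAt ((isOpen_Cyl H).mem_nhds hC)
    haveI : (𝓝[C.B] x).NeBot := mem_closure_iff_nhdsWithin_neBot.1 hcl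
    have h1 : Tendsto (fun x => C.proj x) (𝓝[C.B] x) (𝓝 (C.proj x)) := hcont.tendsto.mono_left nhdsWithin_le_nhds
    have h2 : Tendsto (fun x => C.proj x) (𝓝[C.B] x) (𝓝 x) := by
      have : Tendsto (fun x : Fin m → ℝ => x) (𝓝[C.B] x) (𝓝 x) := tendsto_id.mono_left nhdsWithin_le_nhds
      exact this.congr' (eventually_nhdsWithin_of_forall fun x' hx' => (proj_of_mem H hx').symm)
    exact tendsto_nhds_unique h1 h2
  · rintro ⟨hcl, hnC⟩
    exact ⟨hcl, fun hB => hnC (mem_Cyl_of_mem H hB)⟩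

/-- The frontier `cl B ∖ B` is compact. [cite: Dries1998, Ch. 3 (2.7)] -/
theorem isCompact_closure_diff : IsCompact (closure C.B \ C.B) := by
  rw [closure_diff_eq H]
  exact H.B_bdd.isCompact_closure.diff (isOpen_Cyl H)

omit H in
/-- `δU` is continuous. [cite: Pawlucki2024, Prop. 2.5] -/
theorem continuous_δU : Continuous C.δU := by
  unfold δU; split_ifs
  · exact continuous_infDist_pt _
  · exact continuous_const

/-- `δU > 0` on the chart domain. [cite: Pawlucki2024, Prop. 2.5] -/
theorem δU_pos {u : Fin k → ℝ} (hu : u ∈ C.U) : 0 < C.δU u := by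
  unfold δU; split_ifs with h
  · exact (infDist_compl_pos_iff H.isOpen_U h).2 hu
  · exact one_pos

omit H in
/-- `δU u ≤ dist u w` for `w ∉ U`. [cite: Pawlucki2024, Prop. 2.5] -/
theorem δU_le_dist {u w : Fin k → ℝ} (hw : w ∉ C.U) : C.δU u ≤ dist u w := by
  unfold δU; rw [if_pos ⟨w, hw⟩]; exact infDist_le_dist_of_mem hw

/-! #### Semialgebraicity of the chart maps -/

omit H in
/-- `pr` is a semialgebraic map. [cite: BochnakCosteRoy1998, §2.2] -/
theorem pr_sa : IsSemialgebraicMapOn ℝ univ C.pr :=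
  IsSemialgebraicMapOn.of_forall isSemialgebraic_univ fun j => isSemialgebraicFunOn_apply isSemialgebraic_univ (C.ι j)

omit H in
/-- The cylinder is semialgebraic. [cite: BochnakCosteRoy1998, §2.2] -/
theorem Cyl_sa (S : C.SA) : IsSemialgebraic ℝ C.Cyl := by
  have h := IsSemialgebraicMapOn.isSemialgebraic_sep_mem (pr_sa (C := C)) S.U_sa
  convert h using 1
  ext x; simp [Cyl]

omit H in
/-- `proj` is a semialgebraic map on the cylinder. [cite: BochnakCosteRoy1998, §2.2] -/
theorem proj_sa (S : C.SA) : IsSemialgebraicMapOn ℝ C.Cyl C.proj := by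
  have hφj := (isSemialgebraicMapOn_iff_forall_holds S.U_sa).1 S.φ_sa
  refine IsSemialgebraicMapOn.of_forall (Cyl_sa S) fun j => ?_
  exact IsSemialgebraicFunOn.comp_isSemialgebraicMapOn_holds (hφj j)
    ((pr_sa (C := C)).mono (subset_univ _) (Cyl_sa S)) fun x hx => hx

omit H in
/-- `tdist` is semialgebraic on the cylinder. [cite: BochnakCosteRoy1998, Prop. 2.2.8] -/
theorem tdist_sa (S : C.SA) : IsSemialgebraicFunOn ℝ C.Cyl C.tdist :=
  isSemialgebraicFunOn_dist_map (Cyl_sa S) (proj_sa S)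

omit H in
/-- `δU` is semialgebraic. [cite: BochnakCosteRoy1998, Prop. 2.2.8] -/
theorem δU_sa (S : C.SA) : IsSemialgebraicFunOn ℝ univ C.δU := by
  unfold δU; split_ifs
  · exact isSemialgebraicFunOn_infDist S.U_sa.compl
  · exact isSemialgebraicFunOn_const' isSemialgebraic_univ 1

end ChartData

end Chart

/-! ### Ladders over a stratum inside a free window -/

section Ladder

variable {m k q : ℕ}

/-- The data of a thick ladder: a chart, the cover, the window `[γ, δ]` over the free base `Fr`,
the ladder `ψ` with `M` pieces and their cover indices `jb`, and the set `K` to be served.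
[cite: Pawlucki2024, Prop. 2.5 (proof, Part II)] -/
structure LadderData (m k q : ℕ) extends ChartData m k where
  /-- the cover -/
  V : Fin q → Set (Fin (m + 1) → ℝ)
  /-- cover index of the `ν`-th piece -/
  jb : ℕ → Fin q
  /-- bottom of the window -/
  γ : (Fin m → ℝ) → ℝ
  /-- top of the window -/
  δ : (Fin m → ℝ) → ℝ
  /-- the ladder -/
  ψ : ℕ → (Fin m → ℝ) → ℝ
  /-- number of pieces -/
  M : ℕ
  /-- the free base -/
  Fr : Set (Fin m → ℝ)
  /-- the set to be served -/
  K : Set (Fin m → ℝ)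

/-- Hypotheses of a thick ladder (topological layer). [cite: Pawlucki2024, Prop. 2.5 (proof, Part II)] -/
structure LadderData.Hyp (L : LadderData m k q) : Prop extends L.toChartData.Hyp where
  isOpen_V : ∀ j, IsOpen (L.V j)
  γ_cont : Continuous L.γ
  δ_cont : Continuous L.δ
  ψ_cont : ∀ ν, ContinuousOn (L.ψ ν) L.B
  ψ_zero : ∀ y ∈ L.B, L.ψ 0 y = L.γ y
  ψ_top : ∀ y ∈ L.B, ∀ ν, L.M ≤ ν → L.ψ ν y = L.δ y
  ψ_lt : ∀ y ∈ L.B, ∀ ν < L.M, L.ψ ν y < L.ψ (ν + 1) y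
  M_pos : 0 < L.M
  piece : ∀ ν < L.M, ∀ y ∈ L.B, ∀ t ∈ Icc (L.ψ ν y) (L.ψ (ν + 1) y),
    (Fin.snoc y t : Fin (m + 1) → ℝ) ∈ L.V (L.jb ν)
  B_sub : L.B ⊆ L.Fr
  pinch : ∀ z ∈ closure L.Fr, z ∉ L.Fr → L.γ z = L.δ z
  K_sub : L.K ⊆ L.B
  K_sep : ∀ z ∈ closure L.K, z ∈ closure L.B → z ∉ L.B → z ∉ L.Fr
  K_ne : L.K.Nonempty

namespace LadderData

variable (L : LadderData m k q)

/-- The spine `(γ + δ)/2`. [cite: Pawlucki2024, p. 3872] -/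
def spine (x : Fin m → ℝ) : ℝ := (L.γ x + L.δ x) / 2

/-- Tube width `κ = min 1 (δU ∘ pr)` (pinches towards the frontier of the chart domain).
[cite: Pawlucki2024, p. 3872] -/
def κ (y : Fin m → ℝ) : ℝ := min 1 (L.δU (L.pr y))

/-- The tube cutoff `θ` (`1` for `d ≤ κ/2`, `0` for `d ≥ κ` and off the cylinder). [cite: Pawlucki2024, p. 3872] -/
def θ (x : Fin m → ℝ) : ℝ := by
  classical
  exact if x ∈ L.Cyl then LensData.clamp01 (2 - 2 * L.tdist x / L.κ (L.proj x)) else 0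

/-- The nondegenerate frontier `E_B = ∂B ∩ Fr` of the stratum. [cite: Pawlucki2024, p. 3872] -/
def EB : Set (Fin m → ℝ) := (closure L.B \ L.B) ∩ L.Fr

/-- Distance to `E_B` (`1` if empty). [cite: Pawlucki2024, p. 3872] -/
def dE (x : Fin m → ℝ) : ℝ := by
  classical
  exact if L.EB.Nonempty then infDist x L.EB else 1

/-- Distance to `K`. [cite: Pawlucki2024, p. 3872] -/
def dK (x : Fin m → ℝ) : ℝ := infDist x L.K

/-- The separation cutoff `χ` (`1` where `dist(·, K) ≤ dist(·, E_B)`, `→ 0` at `E_B`).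
[cite: Pawlucki2024, p. 3872] -/
def χ (x : Fin m → ℝ) : ℝ := LensData.clamp01 (2 * L.dE x / (L.dE x + L.dK x))

/-- **The cut functions** `c_ν = spine + χ θ (ψ_ν ∘ π - spine)`. [cite: Pawlucki2024, p. 3872] -/
def cut (ν : ℕ) (x : Fin m → ℝ) : ℝ := L.spine x + L.χ x * L.θ x * (L.ψ ν (L.proj x) - L.spine x)

/-- Distance to the complement of `V j` (`1` if empty). [cite: Pawlucki2024, Prop. 2.5] -/
def GV (j : Fin q) (z : Fin (m + 1) → ℝ) : ℝ := by
  classical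
  exact if ((L.V j)ᶜ).Nonempty then infDist z (L.V j)ᶜ else 1

/-- Distance of the `ν`-th piece over `y` to the complement of its `V`:
`G_ν(y) = min_{t ∈ [ψ_ν y, ψ_{ν+1} y]} GV_{jb ν}(y, t)`. [cite: Pawlucki2024, p. 3872] -/
def Gp (ν : ℕ) (y : Fin m → ℝ) : ℝ := paramMin (fun y t => L.GV (L.jb ν) (Fin.snoc y t)) (L.ψ (ν + 1)) y (L.ψ ν y)

/-- Running minimum over the pieces `0, …, n`. [cite: Pawlucki2024, p. 3872] -/
def Gmin (n : ℕ) (y : Fin m → ℝ) : ℝ :=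
  Nat.rec (L.Gp 0 y) (fun n r => min r (L.Gp (n + 1) y)) n

omit L in
/-- Unfolding `Gmin` at `0`. [cite: Pawlucki2024, p. 3872] -/
theorem Gmin_zero (L : LadderData m k q) (y : Fin m → ℝ) : L.Gmin 0 y = L.Gp 0 y := rfl

omit L in
/-- Unfolding `Gmin` at a successor. [cite: Pawlucki2024, p. 3872] -/
theorem Gmin_succ (L : LadderData m k q) (n : ℕ) (y : Fin m → ℝ) :
    L.Gmin (n + 1) y = min (L.Gmin n y) (L.Gp (n + 1) y) := rfl

/-- The disc radius `r₁ = (min_ν G_ν)/2`. [cite: Pawlucki2024, p. 3872] -/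
def r₁ (y : Fin m → ℝ) : ℝ := L.Gmin (L.M - 1) y / 2

/-- Bottom end guard: distance of the corner `(y, γ y)` to the complement of `V (jb 0)`. [cite: Pawlucki2024, p. 3872] -/
def g₀ (y : Fin m → ℝ) : ℝ := L.GV (L.jb 0) (Fin.snoc y (L.γ y))

/-- Top end guard. [cite: Pawlucki2024, p. 3872] -/
def gM (y : Fin m → ℝ) : ℝ := L.GV (L.jb (L.M - 1)) (Fin.snoc y (L.δ y))

/-- **The validity region** `U_B`. [cite: Pawlucki2024, p. 3872] -/
def UB : Set (Fin m → ℝ) :=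
  {x | x ∈ L.Cyl ∧ L.tdist x < L.κ (L.proj x) / 2 ∧ L.dK x < L.dE x ∧ L.tdist x < L.r₁ (L.proj x) ∧
    |L.γ x - L.γ (L.proj x)| < L.g₀ (L.proj x) ∧ |L.δ x - L.δ (L.proj x)| < L.gM (L.proj x)}

variable {L} (H : L.Hyp)
include H

/-! #### Ladder basics -/

/-- The ladder is monotone in the index. [cite: Pawlucki2024, p. 3872] -/
theorem ψ_mono {y : Fin m → ℝ} (hy : y ∈ L.B) : Monotone fun ν => L.ψ ν y := by
  refine monotone_nat_of_le_succ fun ν => ?_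
  by_cases hν : ν < L.M
  · exact (H.ψ_lt y hy ν hν).le
  · rw [H.ψ_top y hy ν (not_lt.1 hν), H.ψ_top y hy (ν + 1) ((not_lt.1 hν).trans (Nat.le_succ ν))]

/-- The ladder lies in the window. [cite: Pawlucki2024, p. 3872] -/
theorem ψ_mem {y : Fin m → ℝ} (hy : y ∈ L.B) (ν : ℕ) : L.ψ ν y ∈ Icc (L.γ y) (L.δ y) := by
  have hm := ψ_mono H hy
  constructor
  · rw [← H.ψ_zero y hy]; exact hm (Nat.zero_le ν)
  · rw [← H.ψ_top y hy (max ν L.M) (le_max_right _ _)]; exact hm (le_max_left _ _)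

/-- `γ < δ` on the stratum. [cite: Pawlucki2024, p. 3872] -/
theorem γ_lt_δ {y : Fin m → ℝ} (hy : y ∈ L.B) : L.γ y < L.δ y := by
  have h := H.ψ_lt y hy 0 H.M_pos
  rw [H.ψ_zero y hy] at h
  exact h.trans_le (ψ_mem H hy 1).2

/-- `δ = ψ_M`. [cite: Pawlucki2024, p. 3872] -/
theorem ψ_M {y : Fin m → ℝ} (hy : y ∈ L.B) : L.ψ L.M y = L.δ y := H.ψ_top y hy L.M le_rfl

omit H in
/-- The spine is continuous. [cite: Pawlucki2024, p. 3872] -/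
theorem continuous_spine (H : L.Hyp) : Continuous L.spine := (H.γ_cont.add H.δ_cont).div_const _

omit H in
/-- `|ψ_ν y - spine y| ≤ (δ - γ) y` on the stratum. [cite: Pawlucki2024, p. 3872] -/
theorem abs_ψ_sub_spine_le (H : L.Hyp) {y : Fin m → ℝ} (hy : y ∈ L.B) (ν : ℕ) :
    |L.ψ ν y - L.spine y| ≤ L.δ y - L.γ y := by
  have h := ψ_mem H hy ν
  unfold spine
  rw [abs_le]
  constructor <;> linarith [h.1, h.2]

/-! #### The frontier sets -/

omit H in
/-- `E_B` lies in the frontier of the stratum. [cite: Pawlucki2024, p. 3872] -/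
theorem EB_subset : L.EB ⊆ closure L.B \ L.B := inter_subset_left

/-- Points of `E_B` are not in the cylinder. [cite: Dries1998, Ch. 3 (2.7)] -/
theorem not_mem_Cyl_of_mem_closure_EB {x : Fin m → ℝ} (hx : x ∈ closure L.EB) : x ∉ L.Cyl := by
  have h1 : closure L.EB ⊆ closure (closure L.B \ L.B) := closure_mono (EB_subset (L := L))
  have h2 : closure (closure L.B \ L.B) = closure L.B \ L.B :=
    (ChartData.isCompact_closure_diff H.toHyp).isClosed.closure_eq
  have hx' := h1 hx
  rw [h2, ChartData.closure_diff_eq H.toHyp] at hx'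
  exact hx'.2

/-- `dE > 0` on the cylinder. [cite: Pawlucki2024, p. 3872] -/
theorem dE_pos_of_mem_Cyl {x : Fin m → ℝ} (hx : x ∈ L.Cyl) : 0 < L.dE x := by
  unfold dE
  split_ifs with hne
  · exact (infDist_pos_iff_notMem_closure hne).1 fun h => not_mem_Cyl_of_mem_closure_EB H h hx
  · exact one_pos

omit H in
/-- `dE` is continuous. [cite: Pawlucki2024, p. 3872] -/
theorem continuous_dE : Continuous L.dE := by
  unfold dE; split_ifs
  · exact continuous_infDist_pt _
  · exact continuous_const

omit H in
/-- `dE ≥ 0`. [cite: Pawlucki2024, p. 3872] -/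
theorem dE_nonneg (x : Fin m → ℝ) : 0 ≤ L.dE x := by
  unfold dE; split_ifs
  · exact infDist_nonneg
  · exact zero_le_one

omit H in
/-- `dE ≤ dist · z` for `z ∈ E_B`. [cite: Pawlucki2024, p. 3872] -/
theorem dE_le_dist {x z : Fin m → ℝ} (hz : z ∈ L.EB) : L.dE x ≤ dist x z := by
  unfold dE; rw [if_pos ⟨z, hz⟩]; exact infDist_le_dist_of_mem hz

omit H in
/-- `dK` is continuous and nonnegative, `1`-Lipschitz. [cite: Pawlucki2024, p. 3872] -/
theorem continuous_dK : Continuous L.dK := continuous_infDist_pt _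

/-- `dK x₀ > 0` at points of `E_B`. [cite: Pawlucki2024, p. 3872] -/
theorem dK_pos_of_mem_EB {x : Fin m → ℝ} (hx : x ∈ L.EB) : 0 < L.dK x := by
  unfold dK
  refine (infDist_pos_iff_notMem_closure H.K_ne).1 fun hcl => ?_
  exact H.K_sep x hcl hx.1.1 hx.1.2 hx.2

/-- On `K`, `dK = 0 < dE`. [cite: Pawlucki2024, p. 3872] -/
theorem dK_lt_dE_of_mem_K {y : Fin m → ℝ} (hy : y ∈ L.K) : L.dK y < L.dE y := by
  unfold dK; rw [infDist_zero_of_mem hy]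
  exact dE_pos_of_mem_Cyl H (ChartData.mem_Cyl_of_mem H.toHyp (H.K_sub hy))

/-! #### The cutoffs -/

omit H in
/-- `κ` is continuous. [cite: Pawlucki2024, p. 3872] -/
theorem continuous_κ : Continuous L.κ :=
  continuous_const.min (ChartData.continuous_δU.comp ChartData.continuous_pr)

/-- `κ > 0` on the cylinder (and the stratum). [cite: Pawlucki2024, p. 3872] -/
theorem κ_pos {x : Fin m → ℝ} (hx : x ∈ L.Cyl) : 0 < L.κ x :=
  lt_min one_pos (ChartData.δU_pos H.toHyp hx)

omit H in
/-- `κ ≤ δU ∘ pr`. [cite: Pawlucki2024, p. 3872] -/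
theorem κ_le_δU (y : Fin m → ℝ) : L.κ y ≤ L.δU (L.pr y) := min_le_right _ _

omit H in
/-- `κ ≤ 1`. [cite: Pawlucki2024, p. 3872] -/
theorem κ_le_one (y : Fin m → ℝ) : L.κ y ≤ 1 := min_le_left _ _

/-- `κ ∘ proj > 0` on the cylinder. [cite: Pawlucki2024, p. 3872] -/
theorem κ_proj_pos {x : Fin m → ℝ} (hx : x ∈ L.Cyl) : 0 < L.κ (L.proj x) :=
  κ_pos H (ChartData.mem_Cyl_of_mem H.toHyp (ChartData.proj_mem H.toHyp hx))

/-- `θ` is continuous on the cylinder. [cite: Pawlucki2024, p. 3872] -/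
theorem continuousOn_θ : ContinuousOn L.θ L.Cyl := by
  classical
  have h : ContinuousOn (fun x => LensData.clamp01 (2 - 2 * L.tdist x / L.κ (L.proj x))) L.Cyl := by
    refine LensData.continuous_clamp01.comp_continuousOn ?_
    refine continuousOn_const.sub ((continuousOn_const.mul (ChartData.continuousOn_tdist H.toHyp)).div
      (continuous_κ.comp_continuousOn (ChartData.continuousOn_proj H.toHyp)) fun x hx => (κ_proj_pos H hx).ne')
  refine h.congr fun x hx => ?_
  unfold θ; rw [if_pos hx]

omit H in
/-- `θ ∈ [0, 1]`. [cite: Pawlucki2024, p. 3872] -/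
theorem θ_mem (x : Fin m → ℝ) : L.θ x ∈ Icc (0 : ℝ) 1 := by
  classical
  unfold θ; split_ifs
  · exact LensData.clamp01_mem _
  · exact ⟨le_rfl, zero_le_one⟩

omit H in
/-- `θ = 0` off the cylinder. [cite: Pawlucki2024, p. 3872] -/
theorem θ_of_not_mem {x : Fin m → ℝ} (hx : x ∉ L.Cyl) : L.θ x = 0 := by
  classical
  unfold θ; rw [if_neg hx]

/-- `θ = 0` on the cylinder outside the tube `d < κ ∘ proj`. [cite: Pawlucki2024, p. 3872] -/
theorem θ_of_le {x : Fin m → ℝ} (hx : x ∈ L.Cyl) (hd : L.κ (L.proj x) ≤ L.tdist x) : L.θ x = 0 := by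
  classical
  unfold θ; rw [if_pos hx]
  have hκ := κ_proj_pos H hx
  have h : 2 - 2 * L.tdist x / L.κ (L.proj x) ≤ 0 := by
    rw [sub_nonpos, le_div_iff₀ hκ]; linarith
  unfold LensData.clamp01
  rw [max_eq_left]
  exact (min_le_left _ _).trans h

/-- `θ = 1` where `d < κ/2`. [cite: Pawlucki2024, p. 3872] -/
theorem θ_of_lt {x : Fin m → ℝ} (hx : x ∈ L.Cyl) (hd : L.tdist x < L.κ (L.proj x) / 2) : L.θ x = 1 := by
  classical
  unfold θ; rw [if_pos hx]
  have hκ := κ_proj_pos H hx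
  have h : 1 ≤ 2 - 2 * L.tdist x / L.κ (L.proj x) := by
    have : 2 * L.tdist x / L.κ (L.proj x) < 1 := by rw [div_lt_one hκ]; linarith
    linarith
  unfold LensData.clamp01
  rw [min_eq_right h, max_eq_right zero_le_one]

omit H in
/-- `χ` is continuous where `dE + dK > 0`. [cite: Pawlucki2024, p. 3872] -/
theorem continuousAt_χ {x : Fin m → ℝ} (hx : 0 < L.dE x + L.dK x) : ContinuousAt L.χ x := by
  unfold χ
  refine LensData.continuous_clamp01.continuousAt.comp ?_
  exact ((continuous_const.mul continuous_dE).continuousAt).div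
    ((continuous_dE.add continuous_dK).continuousAt) hx.ne'

omit H in
/-- `χ ∈ [0, 1]`. [cite: Pawlucki2024, p. 3872] -/
theorem χ_mem (x : Fin m → ℝ) : L.χ x ∈ Icc (0 : ℝ) 1 := LensData.clamp01_mem _

omit H in
/-- `χ = 1` where `dK < dE`. [cite: Pawlucki2024, p. 3872] -/
theorem χ_of_lt {x : Fin m → ℝ} (h : L.dK x < L.dE x) : L.χ x = 1 := by
  unfold χ
  have hK : 0 ≤ L.dK x := infDist_nonneg
  have hpos : 0 < L.dE x + L.dK x := by linarith
  have h1 : 1 ≤ 2 * L.dE x / (L.dE x + L.dK x) := by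
    rw [le_div_iff₀ hpos]; linarith
  unfold LensData.clamp01
  rw [min_eq_right h1, max_eq_right zero_le_one]

omit H in
/-- `χ ≤ 2 dE / dK`. [cite: Pawlucki2024, p. 3872] -/
theorem χ_le {x : Fin m → ℝ} (hK : 0 < L.dK x) : L.χ x ≤ 2 * L.dE x / L.dK x := by
  unfold χ LensData.clamp01
  have hE := dE_nonneg (L := L) x
  refine max_le (div_nonneg (by linarith) hK.le) ((min_le_left _ _).trans ?_)
  exact div_le_div_of_nonneg_left (by linarith) hK (by linarith)

/-! #### Key estimate for tube points -/

/-- **Tube points near a point outside the cylinder project close to it**: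
`d x < κ (proj x) ⇒ dist (proj x) z ≤ 2 dist x z` for `z ∉ Cyl`. [cite: Pawlucki2024, p. 3872] -/
theorem dist_proj_le {x z : Fin m → ℝ} (hx : x ∈ L.Cyl) (hd : L.tdist x < L.κ (L.proj x)) (hz : z ∉ L.Cyl) :
    dist (L.proj x) z ≤ 2 * dist x z := by
  have h1 : L.tdist x ≤ dist x z := by
    calc L.tdist x ≤ L.κ (L.proj x) := hd.le
      _ ≤ L.δU (L.pr (L.proj x)) := κ_le_δU _
      _ = L.δU (L.pr x) := by rw [ChartData.pr_proj H.toHyp hx]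
      _ ≤ dist (L.pr x) (L.pr z) := ChartData.δU_le_dist hz
      _ ≤ dist x z := ChartData.dist_pr_le x z
  calc dist (L.proj x) z ≤ dist (L.proj x) x + dist x z := dist_triangle _ _ _
    _ = L.tdist x + dist x z := by unfold ChartData.tdist; rw [dist_comm]
    _ ≤ 2 * dist x z := by linarith

/-! #### Continuity of the cut functions -/

/-- Continuity of `c_ν` at points off the cylinder (at `E_B`: `χ → 0`; at the rim: squeeze
`γ = δ`; elsewhere: no tube points nearby). [cite: Pawlucki2024, p. 3872] -/
theorem continuousAt_cut_of_not_mem {x₀ : Fin m → ℝ} (hx₀ : x₀ ∉ L.Cyl) (ν : ℕ) :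
    ContinuousAt (L.cut ν) x₀ := by
  have hval : L.cut ν x₀ = L.spine x₀ := by unfold cut; rw [θ_of_not_mem hx₀]; ring
  rw [Metric.continuousAt_iff]
  intro ε₀ hε₀
  -- work with `ε = min ε₀ 1`
  set ε := min ε₀ 1 with hε_def
  have hε : 0 < ε := lt_min hε₀ one_pos
  have hε1 : ε ≤ 1 := min_le_right _ _
  have hεε₀ : ε ≤ ε₀ := min_le_left _ _
  suffices h : ∃ δ > 0, ∀ {x : Fin m → ℝ}, dist x x₀ < δ → dist (L.cut ν x) (L.cut ν x₀) < ε by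
    obtain ⟨δ, hδ, h⟩ := h
    exact ⟨δ, hδ, fun x hx => (h hx).trans_le hεε₀⟩
  have hsp := continuous_spine H
  obtain ⟨δ₁, hδ₁, hsp₁⟩ := Metric.continuousAt_iff.1 (hsp.continuousAt (x := x₀)) (ε / 8) (by linarith)
  obtain ⟨δ₂, hδ₂, hγ₂⟩ := Metric.continuousAt_iff.1 (H.γ_cont.continuousAt (x := x₀)) (ε / 16) (by linarith)
  obtain ⟨δ₃, hδ₃, hδ₃'⟩ := Metric.continuousAt_iff.1 (H.δ_cont.continuousAt (x := x₀)) (ε / 16) (by linarith)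
  -- a common bound for the deviation term on tube points
  have hdev_tube : ∀ {x : Fin m → ℝ}, dist x x₀ < δ₁ / 2 → dist x x₀ < δ₂ / 2 → dist x x₀ < δ₃ / 2 →
      x ∈ L.Cyl → L.tdist x < L.κ (L.proj x) →
      |L.ψ ν (L.proj x) - L.spine x| ≤ (L.δ x₀ - L.γ x₀) + ε / 2 := by
    intro x hx1 hx2 hx3 hxC htube
    have hpd : dist (L.proj x) x₀ ≤ 2 * dist x x₀ := dist_proj_le H hxC htube hx₀
    have hpm := ChartData.proj_mem H.toHyp hxC
    have hγp : dist (L.γ (L.proj x)) (L.γ x₀) < ε / 16 := hγ₂ (by linarith)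
    have hδp : dist (L.δ (L.proj x)) (L.δ x₀) < ε / 16 := hδ₃' (by linarith)
    have h1 : |L.ψ ν (L.proj x) - L.spine (L.proj x)| ≤ L.δ (L.proj x) - L.γ (L.proj x) :=
      abs_ψ_sub_spine_le H hpm ν
    have h2 : dist (L.spine (L.proj x)) (L.spine x₀) < ε / 8 := hsp₁ (by linarith)
    have h3 : dist (L.spine x) (L.spine x₀) < ε / 8 := hsp₁ (by linarith)
    rw [Real.dist_eq, abs_lt] at hγp hδp h2 h3
    rw [abs_le] at h1 ⊢
    constructor <;> linarith [h1.1, h1.2]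
  by_cases hEB : x₀ ∈ L.EB
  · -- at `E_B`: `χ → 0` and the deviation term is bounded
    have hKpos := dK_pos_of_mem_EB H hEB
    set C := |L.δ x₀ - L.γ x₀| + 1 with hC
    have hCpos : 0 < C := by positivity
    obtain ⟨δ₄, hδ₄, hK₄⟩ := Metric.continuousAt_iff.1 ((continuous_dK (L := L)).continuousAt (x := x₀)) (L.dK x₀ / 2)
      (by linarith)
    refine ⟨min (min (δ₁ / 2) (min (δ₂ / 2) (δ₃ / 2))) (min δ₄ (ε * L.dK x₀ / (16 * C))),
      by positivity, fun {x} hx => ?_⟩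
    simp only [lt_min_iff] at hx
    obtain ⟨⟨hx1, hx2, hx3⟩, hx4, hx5⟩ := hx
    rw [hval, Real.dist_eq]
    have hspx : |L.spine x - L.spine x₀| < ε / 8 := by rw [← Real.dist_eq]; exact hsp₁ (by linarith)
    have hdev : |L.χ x * L.θ x * (L.ψ ν (L.proj x) - L.spine x)| ≤ ε / 2 := by
      by_cases hxC : x ∈ L.Cyl
      · by_cases htube : L.tdist x < L.κ (L.proj x)
        · have hbr : |L.ψ ν (L.proj x) - L.spine x| ≤ C := by
            have h := hdev_tube hx1 hx2 hx3 hxC htube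
            have hC' : L.δ x₀ - L.γ x₀ ≤ |L.δ x₀ - L.γ x₀| := le_abs_self _
            linarith
          have hKx : L.dK x₀ / 2 < L.dK x := by
            have := hK₄ hx4; rw [Real.dist_eq, abs_lt] at this; linarith
          have hKxpos : 0 < L.dK x := by linarith
          have hEx : L.dE x ≤ dist x x₀ := dE_le_dist hEB
          have hχ : L.χ x ≤ 2 * L.dE x / L.dK x := χ_le hKxpos
          have hχ' : L.χ x ≤ ε / (2 * C) := by
            refine hχ.trans ?_
            rw [div_le_div_iff₀ hKxpos (by positivity)]
            have h5 : dist x x₀ < ε * L.dK x₀ / (16 * C) := hx5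
            rw [lt_div_iff₀ (by positivity)] at h5
            nlinarith [hEx, hKx, dE_nonneg (L := L) x, hKpos, hCpos, hε]
          have hθ := θ_mem (L := L) x
          have hχ0 := (χ_mem (L := L) x).1
          calc |L.χ x * L.θ x * (L.ψ ν (L.proj x) - L.spine x)|
              = L.χ x * L.θ x * |L.ψ ν (L.proj x) - L.spine x| := by
                rw [abs_mul, abs_mul, abs_of_nonneg hχ0, abs_of_nonneg hθ.1]
            _ ≤ ε / (2 * C) * 1 * C :=
                mul_le_mul (mul_le_mul hχ' hθ.2 hθ.1 (by positivity)) hbr (abs_nonneg _) (by positivity)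
            _ = ε / 2 := by field_simp
        · rw [θ_of_le H hxC (not_lt.1 htube)]; simp; linarith
      · rw [θ_of_not_mem hxC]; simp; linarith
    calc |L.cut ν x - L.spine x₀| = |(L.spine x - L.spine x₀) + L.χ x * L.θ x * (L.ψ ν (L.proj x) - L.spine x)| := by
          unfold cut; ring_nf
      _ ≤ |L.spine x - L.spine x₀| + |L.χ x * L.θ x * (L.ψ ν (L.proj x) - L.spine x)| := abs_add_le _ _
      _ < ε / 8 + ε / 2 := by linarith
      _ ≤ ε := by linarith
  by_cases hrim : x₀ ∈ closure L.B ∧ x₀ ∉ L.Fr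
  · -- rim point: `γ x₀ = δ x₀`, squeeze
    have hpinch : L.γ x₀ = L.δ x₀ := H.pinch x₀ (closure_mono H.B_sub hrim.1) hrim.2
    refine ⟨min (δ₁ / 2) (min (δ₂ / 2) (δ₃ / 2)), by positivity, fun {x} hx => ?_⟩
    simp only [lt_min_iff] at hx
    obtain ⟨hx1, hx2, hx3⟩ := hx
    rw [hval, Real.dist_eq]
    have hspx : |L.spine x - L.spine x₀| < ε / 8 := by rw [← Real.dist_eq]; exact hsp₁ (by linarith)
    have hdev : |L.χ x * L.θ x * (L.ψ ν (L.proj x) - L.spine x)| ≤ ε / 2 := by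
      by_cases hxC : x ∈ L.Cyl
      · by_cases htube : L.tdist x < L.κ (L.proj x)
        · have hbr : |L.ψ ν (L.proj x) - L.spine x| ≤ ε / 2 := by
            have h := hdev_tube hx1 hx2 hx3 hxC htube
            rw [hpinch, sub_self, zero_add] at h
            exact h
          have hθ := θ_mem (L := L) x
          have hχ := χ_mem (L := L) x
          calc |L.χ x * L.θ x * (L.ψ ν (L.proj x) - L.spine x)|
              = L.χ x * L.θ x * |L.ψ ν (L.proj x) - L.spine x| := by
                rw [abs_mul, abs_mul, abs_of_nonneg hχ.1, abs_of_nonneg hθ.1]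
            _ ≤ 1 * 1 * (ε / 2) :=
                mul_le_mul (mul_le_mul hχ.2 hθ.2 hθ.1 zero_le_one) hbr (abs_nonneg _) (by positivity)
            _ = ε / 2 := by ring
        · rw [θ_of_le H hxC (not_lt.1 htube)]; simp; linarith
      · rw [θ_of_not_mem hxC]; simp; linarith
    calc |L.cut ν x - L.spine x₀| = |(L.spine x - L.spine x₀) + L.χ x * L.θ x * (L.ψ ν (L.proj x) - L.spine x)| := by
          unfold cut; ring_nf
      _ ≤ |L.spine x - L.spine x₀| + |L.χ x * L.θ x * (L.ψ ν (L.proj x) - L.spine x)| := abs_add_le _ _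
      _ < ε / 8 + ε / 2 := by linarith
      _ ≤ ε := by linarith
  · -- neither in `E_B` nor at the rim: then `x₀ ∉ closure B`, no tube points nearby
    have hncl : x₀ ∉ closure L.B := by
      intro hcl
      by_cases hFr : x₀ ∈ L.Fr
      · exact hEB ⟨⟨hcl, fun hB => hx₀ (ChartData.mem_Cyl_of_mem H.toHyp hB)⟩, hFr⟩
      · exact hrim ⟨hcl, hFr⟩
    obtain ⟨δ₅, hδ₅, hfar⟩ : ∃ δ₅ > 0, ∀ y ∈ L.B, δ₅ ≤ dist y x₀ := by
      rw [Metric.mem_closure_iff] at hncl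
      push Not at hncl
      obtain ⟨ε', hε', h⟩ := hncl
      exact ⟨ε', hε', fun y hy => by rw [dist_comm]; exact h y hy⟩
    refine ⟨min δ₁ (δ₅ / 4), by positivity, fun {x} hx => ?_⟩
    simp only [lt_min_iff] at hx
    rw [hval]
    have hθ0 : L.θ x = 0 := by
      by_cases hxC : x ∈ L.Cyl
      · refine θ_of_le H hxC (not_lt.1 fun htube => ?_)
        have hpd := dist_proj_le H hxC htube hx₀
        have := hfar _ (ChartData.proj_mem H.toHyp hxC)
        linarith
      · exact θ_of_not_mem hxC
    have : L.cut ν x = L.spine x := by unfold cut; rw [hθ0]; ring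
    rw [this]
    exact (hsp₁ hx.1).trans (by linarith)

/-- **The cut functions are continuous.** [cite: Pawlucki2024, p. 3872] -/
theorem continuous_cut (ν : ℕ) : Continuous (L.cut ν) := by
  rw [continuous_iff_continuousAt]
  intro x₀
  by_cases hx₀ : x₀ ∈ L.Cyl
  · -- on the open cylinder all factors are continuous
    have hC := ChartData.isOpen_Cyl H.toHyp
    have hθ : ContinuousAt L.θ x₀ := (continuousOn_θ H).continuousAt (hC.mem_nhds hx₀)
    have hK0 : 0 ≤ L.dK x₀ := infDist_nonneg
    have hχ : ContinuousAt L.χ x₀ := continuousAt_χ (by linarith [dE_pos_of_mem_Cyl H hx₀])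
    have hψ : ContinuousAt (fun x => L.ψ ν (L.proj x)) x₀ :=
      ((H.ψ_cont ν).comp (ChartData.continuousOn_proj H.toHyp) fun x hx => ChartData.proj_mem H.toHyp hx).continuousAt
        (hC.mem_nhds hx₀)
    have hsp := (continuous_spine H).continuousAt (x := x₀)
    unfold cut
    exact hsp.add ((hχ.mul hθ).mul (hψ.sub hsp))
  · exact continuousAt_cut_of_not_mem H hx₀ ν

/-! #### Exactness on the validity region -/

/-- On `U_B` the cuts are the translated ladder. [cite: Pawlucki2024, p. 3872] -/
theorem cut_eq_of_mem_UB {x : Fin m → ℝ} (hx : x ∈ L.UB) (ν : ℕ) : L.cut ν x = L.ψ ν (L.proj x) := by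
  unfold cut
  rw [χ_of_lt hx.2.2.1, θ_of_lt H hx.1 hx.2.1]
  ring

/-- `GV j z > 0` for `z ∈ V j`. [cite: Pawlucki2024, p. 3872] -/
theorem GV_pos {j : Fin q} {z : Fin (m + 1) → ℝ} (hz : z ∈ L.V j) : 0 < L.GV j z := by
  unfold GV; split_ifs with h
  · exact (infDist_compl_pos_iff (H.isOpen_V j) h).2 hz
  · exact one_pos

omit H in
/-- `GV j` is continuous. [cite: Pawlucki2024, p. 3872] -/
theorem continuous_GV (j : Fin q) : Continuous (L.GV j) := by
  unfold GV; split_ifs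
  · exact continuous_infDist_pt _
  · exact continuous_const

omit H in
/-- `GV ≥ 0`. [cite: Pawlucki2024, p. 3872] -/
theorem GV_nonneg (j : Fin q) (z : Fin (m + 1) → ℝ) : 0 ≤ L.GV j z := by
  unfold GV; split_ifs
  · exact infDist_nonneg
  · exact zero_le_one

omit H in
/-- The disc argument for `V j`. [cite: Pawlucki2024, p. 3872] -/
theorem mem_V_of_dist_lt {j : Fin q} {z w : Fin (m + 1) → ℝ} (h : dist z w < L.GV j z) : w ∈ L.V j := by
  unfold GV at h
  split_ifs at h with hne
  · exact mem_of_dist_lt_infDist_compl h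
  · rw [not_nonempty_iff_eq_empty, compl_empty_iff] at hne
    rw [hne]; exact mem_univ _

omit H in
/-- `t ↦ GV j (y, t)` is continuous. [cite: Pawlucki2024, p. 3872] -/
theorem continuous_GV_fibre (j : Fin q) (y : Fin m → ℝ) : Continuous fun t => L.GV j (Fin.snoc y t) :=
  (continuous_GV j).comp (continuous_snoc_prod'.comp (Continuous.prodMk_right y))

/-- `G_ν > 0` on the stratum. [cite: Pawlucki2024, p. 3872] -/
theorem Gp_pos {y : Fin m → ℝ} (hy : y ∈ L.B) {ν : ℕ} (hν : ν < L.M) : 0 < L.Gp ν y := by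
  obtain ⟨s, hs, hseq⟩ := exists_paramMin_eq (F := fun y t => L.GV (L.jb ν) (Fin.snoc y t)) (T := L.ψ (ν + 1))
    (y := y) (t := L.ψ ν y) (continuous_GV_fibre (L.jb ν) y).continuousOn (H.ψ_lt y hy ν hν).le
  unfold Gp
  rw [hseq]
  exact GV_pos H (H.piece ν hν y hy s hs)

omit H in
/-- `G_ν ≤ GV (jb ν) (y, t)` on the piece. [cite: Pawlucki2024, p. 3872] -/
theorem Gp_le (y : Fin m → ℝ) (ν : ℕ) {t : ℝ} (ht : t ∈ Icc (L.ψ ν y) (L.ψ (ν + 1) y)) :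
    L.Gp ν y ≤ L.GV (L.jb ν) (Fin.snoc y t) :=
  paramMin_le (F := fun y t => L.GV (L.jb ν) (Fin.snoc y t)) (T := L.ψ (ν + 1))
    ((continuous_GV_fibre (L.jb ν) y).continuousOn) ht

/-- The running minimum is positive. [cite: Pawlucki2024, p. 3872] -/
theorem Gmin_pos {y : Fin m → ℝ} (hy : y ∈ L.B) : ∀ n, n < L.M → 0 < L.Gmin n y
  | 0, h => by rw [Gmin_zero]; exact Gp_pos H hy h
  | n + 1, h => by
    rw [Gmin_succ]
    exact lt_min (Gmin_pos hy n (Nat.lt_of_succ_lt h)) (Gp_pos H hy h)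

omit H in
/-- The running minimum is below each term. [cite: Pawlucki2024, p. 3872] -/
theorem Gmin_le (y : Fin m → ℝ) : ∀ n ν, ν ≤ n → L.Gmin n y ≤ L.Gp ν y
  | 0, ν, h => by rw [Nat.le_zero.1 h, Gmin_zero]
  | n + 1, ν, h => by
    rw [Gmin_succ]
    rcases Nat.of_le_succ h with h' | h'
    · exact (min_le_left _ _).trans (Gmin_le y n ν h')
    · rw [h']; exact min_le_right _ _

/-- `r₁ > 0` on the stratum. [cite: Pawlucki2024, p. 3872] -/
theorem r₁_pos {y : Fin m → ℝ} (hy : y ∈ L.B) : 0 < L.r₁ y := by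
  unfold r₁
  exact half_pos (Gmin_pos H hy _ (Nat.sub_lt H.M_pos one_pos))

omit H in
/-- `2 r₁ ≤ G_ν` for `ν < M`. [cite: Pawlucki2024, p. 3872] -/
theorem two_r₁_le (y : Fin m → ℝ) {ν : ℕ} (hν : ν < L.M) : 2 * L.r₁ y ≤ L.Gp ν y := by
  unfold r₁
  have h := Gmin_le (L := L) y (L.M - 1) ν (Nat.le_sub_one_of_lt hν)
  linarith

/-- `g₀ > 0` on the stratum. [cite: Pawlucki2024, p. 3872] -/
theorem g₀_pos {y : Fin m → ℝ} (hy : y ∈ L.B) : 0 < L.g₀ y := by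
  unfold g₀
  have h := H.piece 0 H.M_pos y hy (L.ψ 0 y) ⟨le_rfl, (H.ψ_lt y hy 0 H.M_pos).le⟩
  rw [H.ψ_zero y hy] at h
  exact GV_pos H h

/-- `M - 1 + 1 = M`. [cite: Pawlucki2024, p. 3872] -/
theorem M_sub_add : L.M - 1 + 1 = L.M := Nat.sub_add_cancel H.M_pos

/-- `gM > 0` on the stratum. [cite: Pawlucki2024, p. 3872] -/
theorem gM_pos {y : Fin m → ℝ} (hy : y ∈ L.B) : 0 < L.gM y := by
  unfold gM
  have hM : L.M - 1 < L.M := Nat.sub_lt H.M_pos one_pos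
  have hle : L.ψ (L.M - 1) y ≤ L.ψ (L.M - 1 + 1) y := (H.ψ_lt y hy _ hM).le
  have h := H.piece (L.M - 1) hM y hy (L.ψ (L.M - 1 + 1) y) ⟨hle, le_rfl⟩
  rw [M_sub_add H, ψ_M H hy] at h
  exact GV_pos H h

/-- `K ⊆ U_B`. [cite: Pawlucki2024, p. 3872] -/
theorem K_subset_UB : L.K ⊆ L.UB := by
  intro y hy
  have hyB := H.K_sub hy
  have hyC := ChartData.mem_Cyl_of_mem H.toHyp hyB
  have hd : L.tdist y = 0 := ChartData.tdist_of_mem H.toHyp hyB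
  have hp : L.proj y = y := ChartData.proj_of_mem H.toHyp hyB
  refine ⟨hyC, ?_, dK_lt_dE_of_mem_K H hy, ?_, ?_, ?_⟩
  · rw [hd]; exact half_pos (κ_proj_pos H hyC)
  · rw [hd, hp]; exact r₁_pos H hyB
  · rw [hp, sub_self, abs_zero]; exact g₀_pos H hyB
  · rw [hp, sub_self, abs_zero]; exact gM_pos H hyB

/-! #### Validity on the region `U_B` -/

omit H in
/-- Sup distance of two `snoc` points. [folklore] -/
theorem dist_snoc_snoc (y x : Fin m → ℝ) (s t : ℝ) :
    dist (Fin.snoc y s : Fin (m + 1) → ℝ) (Fin.snoc x t) = max (dist y x) (dist s t) := by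
  apply le_antisymm
  · refine (dist_pi_le_iff (le_max_of_le_left dist_nonneg)).2 fun i => ?_
    refine Fin.lastCases ?_ (fun j => ?_) i
    · simp only [Fin.snoc_last]; exact le_max_right _ _
    · simp only [Fin.snoc_castSucc]; exact (dist_le_pi_dist y x j).trans (le_max_left _ _)
  · refine max_le ?_ ?_
    · refine (dist_pi_le_iff dist_nonneg).2 fun j => ?_
      have h := dist_le_pi_dist (Fin.snoc y s : Fin (m + 1) → ℝ) (Fin.snoc x t) (Fin.castSucc j)
      simpa only [Fin.snoc_castSucc] using h
    · have h := dist_le_pi_dist (Fin.snoc y s : Fin (m + 1) → ℝ) (Fin.snoc x t) (Fin.last m)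
      simpa only [Fin.snoc_last] using h

/-- **Validity of the translated ladder on `U_B`.** [cite: Pawlucki2024, p. 3872] -/
theorem rcValid_of_mem_UB (𝒞 : Finset ((Fin m → ℝ) → ℝ)) (h𝒞 : ∀ ν ≤ L.M, L.cut ν ∈ 𝒞) {x : Fin m → ℝ}
    (hx : x ∈ L.UB) : RCValid L.γ L.δ L.V 𝒞 x := by
  classical
  have hxC := hx.1
  have hy : L.proj x ∈ L.B := ChartData.proj_mem H.toHyp hxC
  set y := L.proj x with hy_def
  have hcut : ∀ ν, L.cut ν x = L.ψ ν y := fun ν => cut_eq_of_mem_UB H hx ν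
  have hr : L.tdist x < L.r₁ y := hx.2.2.2.1
  have hdxy : dist y x = L.tdist x := by unfold ChartData.tdist; rw [dist_comm]
  refine rcValid_of_forall fun u v hu hv hlt hcons => ?_
  -- every ladder value avoids `(u, v)`
  have havoid : ∀ ν ≤ L.M, L.ψ ν y ≤ u ∨ v ≤ L.ψ ν y := by
    intro ν hν
    by_cases h1 : L.γ x < L.ψ ν y
    · by_cases h2 : L.ψ ν y < L.δ x
      · have hmem : L.ψ ν y ∈ rcCutVals L.γ L.δ 𝒞 x := by
          rw [← hcut ν]
          exact mem_rcCutVals_of_mem (h𝒞 ν hν) (by rw [hcut]; exact h1) (by rw [hcut]; exact h2)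
        exact hcons _ hmem
      · exact Or.inr (hv.trans (not_lt.1 h2))
    · exact Or.inl ((not_lt.1 h1).trans hu)
  -- the disc argument on a translated closed piece
  have hpieceGood : ∀ ν < L.M, Icc u v ⊆ Icc (L.ψ ν y) (L.ψ (ν + 1) y) → RCGood L.V x u v := by
    intro ν hν hsub
    refine ⟨L.jb ν, fun t ht => ?_⟩
    have ht' : t ∈ Icc (L.ψ ν y) (L.ψ (ν + 1) y) := hsub ⟨ht.1.le, ht.2.le⟩
    refine mem_V_of_dist_lt (L := L) (z := Fin.snoc y t) ?_
    rw [dist_snoc_snoc, dist_self, max_eq_left dist_nonneg, hdxy]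
    calc L.tdist x < L.r₁ y := hr
      _ ≤ L.Gp ν y := by linarith [two_r₁_le (L := L) y hν, (r₁_pos H hy).le]
      _ ≤ L.GV (L.jb ν) (Fin.snoc y t) := Gp_le y ν ht'
  by_cases hA : v ≤ L.ψ 0 y
  · -- bottom end bit `(u, v) ⊆ (γ x, γ y]`
    rw [H.ψ_zero y hy] at hA
    refine ⟨L.jb 0, fun t ht => ?_⟩
    refine mem_V_of_dist_lt (L := L) (z := Fin.snoc y (L.γ y)) ?_
    rw [dist_snoc_snoc, hdxy]
    have hg : L.tdist x < L.g₀ y := by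
      have h1 : 2 * L.r₁ y ≤ L.Gp 0 y := two_r₁_le (L := L) y H.M_pos
      have h2 : L.Gp 0 y ≤ L.g₀ y := by
        unfold g₀
        have h := Gp_le (L := L) y 0 (t := L.ψ 0 y) ⟨le_rfl, (H.ψ_lt y hy 0 H.M_pos).le⟩
        rw [H.ψ_zero y hy] at h
        exact h
      linarith [r₁_pos H hy]
    have hγ : dist (L.γ y) t < L.g₀ y := by
      rw [Real.dist_eq, abs_of_nonneg (by linarith [ht.2])]
      have h := hx.2.2.2.2.1
      rw [abs_lt] at h
      linarith [ht.1, h.1, h.2]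
    exact max_lt hg hγ
  · -- `ψ 0 y ≤ u`: take the largest such index
    have h0 : L.ψ 0 y ≤ u := by
      rcases havoid 0 (Nat.zero_le _) with h | h
      · exact h
      · exact absurd (h.trans_lt (not_le.1 hA)) (lt_irrefl _)
    set ν₀ := Nat.findGreatest (fun ν => L.ψ ν y ≤ u) L.M with hν₀
    have hν₀le : ν₀ ≤ L.M := Nat.findGreatest_le _
    have hPν₀ : L.ψ ν₀ y ≤ u :=
      Nat.findGreatest_spec (P := fun ν => L.ψ ν y ≤ u) (m := 0) (Nat.zero_le _) h0
    rcases eq_or_lt_of_le hν₀le with heq | hlt'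
    · -- top end bit `(u, v) ⊆ [δ y, δ x)`
      have hδu : L.δ y ≤ u := by rw [← ψ_M H hy, ← heq]; exact hPν₀
      refine ⟨L.jb (L.M - 1), fun t ht => ?_⟩
      refine mem_V_of_dist_lt (L := L) (z := Fin.snoc y (L.δ y)) ?_
      rw [dist_snoc_snoc, hdxy]
      have hM1 : L.M - 1 < L.M := Nat.sub_lt H.M_pos one_pos
      have hg : L.tdist x < L.gM y := by
        have h1 : 2 * L.r₁ y ≤ L.Gp (L.M - 1) y := two_r₁_le (L := L) y hM1
        have h2 : L.Gp (L.M - 1) y ≤ L.gM y := by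
          unfold gM
          have hle : L.ψ (L.M - 1) y ≤ L.ψ (L.M - 1 + 1) y := (H.ψ_lt y hy _ hM1).le
          have h := Gp_le (L := L) y (L.M - 1) (t := L.ψ (L.M - 1 + 1) y) ⟨hle, le_rfl⟩
          rw [M_sub_add H, ψ_M H hy] at h
          exact h
        linarith [r₁_pos H hy]
      have hδ : dist (L.δ y) t < L.gM y := by
        rw [Real.dist_eq, abs_of_nonpos (by linarith [ht.1])]
        have h := hx.2.2.2.2.2
        rw [abs_lt] at h
        linarith [ht.2, h.1, h.2, hv]
      exact max_lt hg hδ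
    · -- a middle piece
      have hnext : v ≤ L.ψ (ν₀ + 1) y := by
        rcases havoid (ν₀ + 1) hlt' with h | h
        · exact absurd h (Nat.findGreatest_is_greatest (Nat.lt_succ_self ν₀) hlt')
        · exact h
      exact hpieceGood ν₀ hlt' fun t ht => ⟨hPν₀.trans ht.1, ht.2.trans hnext⟩

/-! #### Openness of `U_B` -/

omit H in
/-- Strict inequalities between functions continuous on an open set define open sets. [folklore] -/
theorem isOpen_sep_lt {O : Set (Fin m → ℝ)} (hO : IsOpen O) {f g : (Fin m → ℝ) → ℝ} (hf : ContinuousOn f O)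
    (hg : ContinuousOn g O) : IsOpen {x | x ∈ O ∧ f x < g x} := by
  have h := (hg.sub hf).isOpen_inter_preimage hO isOpen_Ioi (t := Ioi (0 : ℝ))
  convert h using 1
  ext x
  simp only [mem_setOf_eq, mem_inter_iff, mem_preimage, mem_Ioi, Pi.sub_apply, sub_pos]

/-- `G_ν` is continuous on the stratum. [cite: Pawlucki2024, p. 3872] -/
theorem continuousOn_Gp (ν : ℕ) : ContinuousOn (L.Gp ν) L.B := by
  have hF : Continuous fun p : (Fin m → ℝ) × ℝ => L.GV (L.jb ν) (Fin.snoc p.1 p.2) :=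
    (continuous_GV (L.jb ν)).comp continuous_snoc_prod'
  have h := continuousOn_paramMin (X := Fin m → ℝ) (S := L.B) (F := fun y t => L.GV (L.jb ν) (Fin.snoc y t))
    (lo := L.ψ ν) (T := L.ψ (ν + 1)) (H.ψ_cont (ν + 1)) hF.continuousOn
  have h2 := h.comp (continuousOn_id.prodMk (H.ψ_cont ν)) fun y hy => ⟨hy, le_rfl, (ψ_mono H hy) (Nat.le_succ ν)⟩
  exact h2

/-- `Gmin n` is continuous on the stratum. [cite: Pawlucki2024, p. 3872] -/
theorem continuousOn_Gmin : ∀ n, ContinuousOn (L.Gmin n) L.B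
  | 0 => by
    refine (continuousOn_Gp H 0).congr fun y _ => Gmin_zero L y
  | n + 1 => by
    refine (continuousOn_min₂ (continuousOn_Gmin n) (continuousOn_Gp H (n + 1))).congr fun y _ => Gmin_succ L n y

/-- `r₁` is continuous on the stratum. [cite: Pawlucki2024, p. 3872] -/
theorem continuousOn_r₁ : ContinuousOn L.r₁ L.B := (continuousOn_Gmin H _).div_const _

/-- `g₀` is continuous. [cite: Pawlucki2024, p. 3872] -/
theorem continuous_g₀ : Continuous L.g₀ :=
  (continuous_GV (L.jb 0)).comp (continuous_snoc_prod'.comp (continuous_id.prodMk H.γ_cont))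

/-- `gM` is continuous. [cite: Pawlucki2024, p. 3872] -/
theorem continuous_gM : Continuous L.gM :=
  (continuous_GV (L.jb (L.M - 1))).comp (continuous_snoc_prod'.comp (continuous_id.prodMk H.δ_cont))

/-- **`U_B` is open.** [cite: Pawlucki2024, p. 3872] -/
theorem isOpen_UB : IsOpen L.UB := by
  have hO := ChartData.isOpen_Cyl H.toHyp
  have hproj := ChartData.continuousOn_proj H.toHyp
  have htd := ChartData.continuousOn_tdist H.toHyp
  have hmaps : MapsTo L.proj L.Cyl L.B := fun x hx => ChartData.proj_mem H.toHyp hx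
  have h1 : IsOpen {x | x ∈ L.Cyl ∧ L.tdist x < L.κ (L.proj x) / 2} :=
    isOpen_sep_lt hO htd ((continuous_κ.comp_continuousOn hproj).div_const _)
  have h2 : IsOpen {x | x ∈ L.Cyl ∧ L.dK x < L.dE x} :=
    isOpen_sep_lt hO continuous_dK.continuousOn continuous_dE.continuousOn
  have h3 : IsOpen {x | x ∈ L.Cyl ∧ L.tdist x < L.r₁ (L.proj x)} :=
    isOpen_sep_lt hO htd ((continuousOn_r₁ H).comp hproj hmaps)
  have h4 : IsOpen {x | x ∈ L.Cyl ∧ |L.γ x - L.γ (L.proj x)| < L.g₀ (L.proj x)} :=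
    isOpen_sep_lt hO ((H.γ_cont.continuousOn.sub (H.γ_cont.comp_continuousOn hproj)).abs)
      ((continuous_g₀ H).comp_continuousOn hproj)
  have h5 : IsOpen {x | x ∈ L.Cyl ∧ |L.δ x - L.δ (L.proj x)| < L.gM (L.proj x)} :=
    isOpen_sep_lt hO ((H.δ_cont.continuousOn.sub (H.δ_cont.comp_continuousOn hproj)).abs)
      ((continuous_gM H).comp_continuousOn hproj)
  have h := (((h1.inter h2).inter h3).inter h4).inter h5
  convert h using 1
  ext x
  simp only [UB, mem_setOf_eq, mem_inter_iff]
  tauto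

/-! #### The semialgebraic layer -/

/-- Semialgebraicity hypotheses of a thick ladder. [cite: Pawlucki2024, Prop. 2.5 (proof, Part II)] -/
structure SA (L : LadderData m k q) : Prop where
  chart : L.toChartData.SA
  V_sa : ∀ j, IsSemialgebraic ℝ (L.V j)
  γ_sa : IsSemialgebraicFunOn ℝ univ L.γ
  δ_sa : IsSemialgebraicFunOn ℝ univ L.δ
  ψ_sa : ∀ ν, IsSemialgebraicFunOn ℝ L.B (L.ψ ν)
  Fr_sa : IsSemialgebraic ℝ L.Fr
  K_sa : IsSemialgebraic ℝ L.K

variable (S : L.SA)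
include S

omit H in
/-- The spine is semialgebraic. [cite: Pawlucki2024, p. 3872] -/
theorem spine_sa : IsSemialgebraicFunOn ℝ univ L.spine := by
  unfold spine
  exact IsSemialgebraicFunOn.div₀ isSemialgebraic_univ (IsSemialgebraicFunOn.add_holds S.γ_sa S.δ_sa)
    (isSemialgebraicFunOn_const' isSemialgebraic_univ 2)

omit H in
/-- `κ` is semialgebraic. [cite: Pawlucki2024, p. 3872] -/
theorem κ_sa : IsSemialgebraicFunOn ℝ univ L.κ := by
  unfold κ
  refine IsSemialgebraicFunOn.min isSemialgebraic_univ (isSemialgebraicFunOn_const' isSemialgebraic_univ 1) ?_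
  exact IsSemialgebraicFunOn.comp_isSemialgebraicMapOn_holds (ChartData.δU_sa S.chart)
    (ChartData.pr_sa (C := L.toChartData)) fun x _ => mem_univ _

omit H S in
/-- `clamp01` of a semialgebraic function. [cite: BochnakCosteRoy1998, §2.2] -/
theorem clamp01_sa {s : Set (Fin m → ℝ)} (hs : IsSemialgebraic ℝ s) {f : (Fin m → ℝ) → ℝ}
    (hf : IsSemialgebraicFunOn ℝ s f) : IsSemialgebraicFunOn ℝ s (fun x => LensData.clamp01 (f x)) := by
  unfold LensData.clamp01
  exact IsSemialgebraicFunOn.max hs (isSemialgebraicFunOn_const' hs 0)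
    (IsSemialgebraicFunOn.min hs hf (isSemialgebraicFunOn_const' hs 1))

omit H in
/-- `θ` is semialgebraic. [cite: Pawlucki2024, p. 3872] -/
theorem θ_sa : IsSemialgebraicFunOn ℝ univ L.θ := by
  classical
  have hC := ChartData.Cyl_sa S.chart
  have h1 : IsSemialgebraicFunOn ℝ (univ ∩ L.Cyl) (fun x => LensData.clamp01 (2 - 2 * L.tdist x / L.κ (L.proj x))) := by
    rw [univ_inter]
    refine clamp01_sa hC (IsSemialgebraicFunOn.sub_holds (isSemialgebraicFunOn_const' hC 2) ?_)
    refine IsSemialgebraicFunOn.div₀ hC (IsSemialgebraicFunOn.mul_holds (isSemialgebraicFunOn_const' hC 2)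
      (ChartData.tdist_sa S.chart)) ?_
    exact IsSemialgebraicFunOn.comp_isSemialgebraicMapOn_holds (κ_sa S) (ChartData.proj_sa S.chart) fun x _ => mem_univ _
  have h2 : IsSemialgebraicFunOn ℝ (univ \ L.Cyl) (fun _ => (0 : ℝ)) :=
    isSemialgebraicFunOn_const' (isSemialgebraic_univ.diff hC) 0
  have h := IsSemialgebraicFunOn.piecewise_mem h1 h2
  refine h.congr fun x _ => ?_
  unfold θ; rfl

omit H in
/-- `E_B` is semialgebraic. [cite: Pawlucki2024, p. 3872] -/
theorem EB_sa : IsSemialgebraic ℝ L.EB :=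
  ((isSemialgebraic_closure S.chart.B_sa).diff S.chart.B_sa).inter S.Fr_sa

omit H in
/-- `dE` is semialgebraic. [cite: BochnakCosteRoy1998, Prop. 2.2.8] -/
theorem dE_sa : IsSemialgebraicFunOn ℝ univ L.dE := by
  unfold dE; split_ifs
  · exact isSemialgebraicFunOn_infDist (EB_sa S)
  · exact isSemialgebraicFunOn_const' isSemialgebraic_univ 1

omit H in
/-- `dK` is semialgebraic. [cite: BochnakCosteRoy1998, Prop. 2.2.8] -/
theorem dK_sa : IsSemialgebraicFunOn ℝ univ L.dK := isSemialgebraicFunOn_infDist S.K_sa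

omit H in
/-- `χ` is semialgebraic. [cite: Pawlucki2024, p. 3872] -/
theorem χ_sa : IsSemialgebraicFunOn ℝ univ L.χ := by
  unfold χ
  refine clamp01_sa isSemialgebraic_univ ?_
  exact IsSemialgebraicFunOn.div₀ isSemialgebraic_univ
    (IsSemialgebraicFunOn.mul_holds (isSemialgebraicFunOn_const' isSemialgebraic_univ 2) (dE_sa S))
    (IsSemialgebraicFunOn.add_holds (dE_sa S) (dK_sa S))

/-- **The cut functions are semialgebraic.** [cite: Pawlucki2024, p. 3872] -/
theorem cut_sa (ν : ℕ) : IsSemialgebraicFunOn ℝ univ (L.cut ν) := by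
  classical
  have hC := ChartData.Cyl_sa S.chart
  have hsp := spine_sa S
  have h1 : IsSemialgebraicFunOn ℝ (univ ∩ L.Cyl)
      (fun x => L.spine x + L.χ x * L.θ x * (L.ψ ν (L.proj x) - L.spine x)) := by
    rw [univ_inter]
    have hψp : IsSemialgebraicFunOn ℝ L.Cyl (fun x => L.ψ ν (L.proj x)) :=
      IsSemialgebraicFunOn.comp_isSemialgebraicMapOn_holds (S.ψ_sa ν) (ChartData.proj_sa S.chart)
        fun x hx => ChartData.proj_mem H.toHyp hx
    have hspC := hsp.mono (subset_univ _) hC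
    exact IsSemialgebraicFunOn.add_holds hspC (IsSemialgebraicFunOn.mul_holds
      (IsSemialgebraicFunOn.mul_holds ((χ_sa S).mono (subset_univ _) hC) ((θ_sa S).mono (subset_univ _) hC))
      (IsSemialgebraicFunOn.sub_holds hψp hspC))
  have h2 : IsSemialgebraicFunOn ℝ (univ \ L.Cyl) L.spine := hsp.mono (fun x hx => hx.1) (isSemialgebraic_univ.diff hC)
  have h := IsSemialgebraicFunOn.piecewise_mem h1 h2
  refine h.congr fun x _ => ?_
  by_cases hx : x ∈ L.Cyl
  · simp only [hx, if_true]; rfl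
  · simp only [hx, if_false]
    unfold cut; rw [θ_of_not_mem hx]; ring

omit H in
/-- `GV j` is semialgebraic. [cite: BochnakCosteRoy1998, Prop. 2.2.8] -/
theorem GV_sa (j : Fin q) : IsSemialgebraicFunOn ℝ univ (L.GV j) := by
  unfold GV; split_ifs
  · exact isSemialgebraicFunOn_infDist (S.V_sa j).compl
  · exact isSemialgebraicFunOn_const' isSemialgebraic_univ 1

/-- `G_ν` is semialgebraic on the stratum. [cite: Pawlucki2024, p. 3872] -/
theorem Gp_sa (ν : ℕ) : IsSemialgebraicFunOn ℝ L.B (L.Gp ν) := by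
  have hB := S.chart.B_sa
  have hF : IsSemialgebraicFunOn ℝ univ (fun z : Fin (m + 1) → ℝ =>
      (fun y t => L.GV (L.jb ν) (Fin.snoc y t)) (Fin.init z) (z (Fin.last m))) := by
    refine (GV_sa S (L.jb ν)).congr fun z _ => ?_
    simp only [Fin.snoc_init_self]
  have h := isSemialgebraicFunOn_paramMin (S := L.B) (F := fun y t => L.GV (L.jb ν) (Fin.snoc y t))
    (lo := L.ψ ν) (T := L.ψ (ν + 1)) (S.ψ_sa ν) (S.ψ_sa (ν + 1)) hF
    fun y _ => (continuous_GV_fibre (L.jb ν) y).continuousOn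
  -- compose with `y ↦ (y, ψ ν y)`
  have hmap := isSemialgebraicMapOn_snoc hB (S.ψ_sa ν)
  have hmaps : MapsTo (fun y : Fin m → ℝ => (Fin.snoc y (L.ψ ν y) : Fin (m + 1) → ℝ)) L.B
      {z : Fin (m + 1) → ℝ | Fin.init z ∈ L.B ∧ L.ψ ν (Fin.init z) ≤ z (Fin.last m) ∧
        z (Fin.last m) ≤ L.ψ (ν + 1) (Fin.init z)} := by
    intro y hy
    simp only [mem_setOf_eq, Fin.init_snoc, Fin.snoc_last]
    exact ⟨hy, le_rfl, (ψ_mono H hy) (Nat.le_succ ν)⟩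
  have h2 := IsSemialgebraicFunOn.comp_isSemialgebraicMapOn_holds h hmap hmaps
  refine h2.congr fun y _ => ?_
  simp only [Function.comp, Fin.init_snoc, Fin.snoc_last]
  rfl

/-- `Gmin n` is semialgebraic on the stratum. [cite: Pawlucki2024, p. 3872] -/
theorem Gmin_sa : ∀ n, IsSemialgebraicFunOn ℝ L.B (L.Gmin n)
  | 0 => (Gp_sa H S 0).congr fun y _ => Gmin_zero L y
  | n + 1 => (IsSemialgebraicFunOn.min S.chart.B_sa (Gmin_sa n) (Gp_sa H S (n + 1))).congr fun y _ => Gmin_succ L n y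

/-- `r₁` is semialgebraic on the stratum. [cite: Pawlucki2024, p. 3872] -/
theorem r₁_sa : IsSemialgebraicFunOn ℝ L.B L.r₁ := by
  unfold r₁
  exact IsSemialgebraicFunOn.div₀ S.chart.B_sa (Gmin_sa H S _) (isSemialgebraicFunOn_const' S.chart.B_sa 2)

omit H in
/-- `g₀` is semialgebraic. [cite: Pawlucki2024, p. 3872] -/
theorem g₀_sa : IsSemialgebraicFunOn ℝ univ L.g₀ := by
  have hmap := isSemialgebraicMapOn_snoc isSemialgebraic_univ S.γ_sa
  have h := IsSemialgebraicFunOn.comp_isSemialgebraicMapOn_holds (GV_sa S (L.jb 0)) hmap fun x _ => mem_univ _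
  exact h

omit H in
/-- `gM` is semialgebraic. [cite: Pawlucki2024, p. 3872] -/
theorem gM_sa : IsSemialgebraicFunOn ℝ univ L.gM := by
  have hmap := isSemialgebraicMapOn_snoc isSemialgebraic_univ S.δ_sa
  have h := IsSemialgebraicFunOn.comp_isSemialgebraicMapOn_holds (GV_sa S (L.jb (L.M - 1))) hmap fun x _ => mem_univ _
  exact h

omit H S in
/-- Strict inequalities between semialgebraic functions on a semialgebraic set define semialgebraic
sets. [cite: BochnakCosteRoy1998, §2.2] -/
theorem sa_sep_lt {O : Set (Fin m → ℝ)} {f g : (Fin m → ℝ) → ℝ} (hf : IsSemialgebraicFunOn ℝ O f)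
    (hg : IsSemialgebraicFunOn ℝ O g) : IsSemialgebraic ℝ {x | x ∈ O ∧ f x < g x} := by
  have h := (IsSemialgebraicFunOn.sub_holds hg hf).isSemialgebraic_sep_snoc_mem tarski_seidenberg_real_holds
    (T := {z : Fin (m + 1) → ℝ | 0 < z (Fin.last m)}) (sa_const_lt _ _)
  convert h using 1
  ext x
  simp only [mem_setOf_eq, Fin.snoc_last, Pi.sub_apply, sub_pos]

/-- **`U_B` is semialgebraic.** [cite: Pawlucki2024, p. 3872] -/
theorem UB_sa : IsSemialgebraic ℝ L.UB := by
  have hC := ChartData.Cyl_sa S.chart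
  have hproj := ChartData.proj_sa S.chart
  have htd := ChartData.tdist_sa S.chart
  have hmaps : MapsTo L.proj L.Cyl L.B := fun x hx => ChartData.proj_mem H.toHyp hx
  have hcomp : ∀ {f : (Fin m → ℝ) → ℝ}, IsSemialgebraicFunOn ℝ L.B f → IsSemialgebraicFunOn ℝ L.Cyl (fun x => f (L.proj x)) :=
    fun hf => IsSemialgebraicFunOn.comp_isSemialgebraicMapOn_holds hf hproj hmaps
  have hcompu : ∀ {f : (Fin m → ℝ) → ℝ}, IsSemialgebraicFunOn ℝ univ f → IsSemialgebraicFunOn ℝ L.Cyl (fun x => f (L.proj x)) :=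
    fun hf => IsSemialgebraicFunOn.comp_isSemialgebraicMapOn_holds hf hproj fun x _ => mem_univ _
  have hu : ∀ {f : (Fin m → ℝ) → ℝ}, IsSemialgebraicFunOn ℝ univ f → IsSemialgebraicFunOn ℝ L.Cyl f :=
    fun hf => hf.mono (subset_univ _) hC
  have h1 : IsSemialgebraic ℝ {x | x ∈ L.Cyl ∧ L.tdist x < L.κ (L.proj x) / 2} :=
    sa_sep_lt htd (IsSemialgebraicFunOn.div₀ hC (hcompu (κ_sa S)) (isSemialgebraicFunOn_const' hC 2))
  have h2 : IsSemialgebraic ℝ {x | x ∈ L.Cyl ∧ L.dK x < L.dE x} := sa_sep_lt (hu (dK_sa S)) (hu (dE_sa S))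
  have h3 : IsSemialgebraic ℝ {x | x ∈ L.Cyl ∧ L.tdist x < L.r₁ (L.proj x)} := sa_sep_lt htd (hcomp (r₁_sa H S))
  have h4 : IsSemialgebraic ℝ {x | x ∈ L.Cyl ∧ |L.γ x - L.γ (L.proj x)| < L.g₀ (L.proj x)} :=
    sa_sep_lt ((IsSemialgebraicFunOn.sub_holds (hu S.γ_sa) (hcompu S.γ_sa)).abs) (hcompu (g₀_sa S))
  have h5 : IsSemialgebraic ℝ {x | x ∈ L.Cyl ∧ |L.δ x - L.δ (L.proj x)| < L.gM (L.proj x)} :=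
    sa_sep_lt ((IsSemialgebraicFunOn.sub_holds (hu S.δ_sa) (hcompu S.δ_sa)).abs) (hcompu (gM_sa S))
  have h := (((h1.inter h2).inter h3).inter h4).inter h5
  convert h using 1
  ext x
  simp only [UB, mem_setOf_eq, mem_inter_iff]
  tauto

/-! ### The thick ladder theorem -/

open Classical in
/-- **Thick ladders** [Pawlucki2024, Prop. 2.5, proof, Part II, "a similar neighbourhood over every
`B_ν`"]: finitely many continuous semialgebraic cut functions on `ℝᵐ` and an open semialgebraic
neighbourhood `U` of `K` on which the cut family is valid for the window `(γ, δ)`.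
[cite: Pawlucki2024, Prop. 2.5 (proof, Part II)] -/
theorem exists_thick_cuts :
    ∃ (c : Fin (L.M + 1) → (Fin m → ℝ) → ℝ) (U : Set (Fin m → ℝ)),
      (∀ i, Continuous (c i)) ∧ (∀ i, IsSemialgebraicFunOn ℝ univ (c i)) ∧ IsOpen U ∧ IsSemialgebraic ℝ U ∧
      L.K ⊆ U ∧ ∀ x ∈ U, RCValid L.γ L.δ L.V (Finset.univ.image c) x := by
  refine ⟨fun i => L.cut i, L.UB, fun i => continuous_cut H i, fun i => cut_sa H S i, isOpen_UB H, UB_sa H S,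
    K_subset_UB H, fun x hx => rcValid_of_mem_UB H _ (fun ν hν => ?_) hx⟩
  exact Finset.mem_image.2 ⟨⟨ν, Nat.lt_succ_of_le hν⟩, Finset.mem_univ _, rfl⟩

end LadderData

end Ladder

end Literature.ModelTheory.ExponentialFields
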